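import Literature.Analysis.FunctionSpaces.ParametricIntegralSmooth
import Mathlib.Analysis.Calculus.ContDiff.Bounds
import HarnessLib

/-!
# Smooth dependence on parameters of integrals with dominated derivatives

Analysis/FunctionSpaces support file, companion of `ParametricIntegralSmooth.lean` and
`IteratedFDerivParametricIntegral.lean` for integrals over a *non-compact* domain: if
`G : P × U → F` is smooth (`P` finite dimensional, `U` a finite-dimensional normed space with a
measure `ν`) and every iterated derivative of `G` is bounded, uniformly in the parameter `p`, by a
`ν`-integrable function of `u` (the "dominated class", stable under directional derivatives in
`p`), then `p ↦ ∫ G (p, u) dν(u)` is smooth, its iterated derivatives are the integrals of the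
iterated derivatives of the sections, and `‖D^n ∫ G‖ ≤ ∫ b_n`. Typical instance: velocity moments
`x ↦ ∫ h (x, u) du` of functions with Schwartz-type bounds
`‖D^n h (x, u)‖ ≤ C_n (1 + |u|)^{-d-1}`. Everything is proved; theorems only.

* `continuous_parametric_integral_of_dominated`, `hasFDerivAt_parametric_integral_of_dominated`
  (Mathlib's `hasFDerivAt_integral_of_dominated_of_fderiv_le` with the global bound `b₁`),
  `fderiv_parametric_integral_of_dominated_apply`, `dominated_fderiv_apply` (stability of the
  class: `‖D^n (q ↦ DG q (v,0))‖ ≤ |v| ‖D^{n+1} G‖`), `contDiff_nat_parametric_integral_of_dominated`,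
  `contDiff_parametric_integral_of_dominated`.
* `iteratedFDeriv_section_left`, `norm_iteratedFDeriv_section_left_le`,
  `contDiff_iteratedFDeriv_section_left`, `dominated_iteratedFDeriv_section_zero_one`,
  `iteratedFDeriv_parametric_integral_of_dominated`,
  `norm_iteratedFDeriv_parametric_integral_of_dominated_le`.

## References

* L. Hörmander, *The Analysis of Linear Partial Differential Operators I*, 2nd ed. (1990),
  Thm. 1.1.9.
-/

noncomputable section

open MeasureTheory Set Filter Topology Metric
open scoped ContDiff

namespace Literature.Analysis.FunctionSpaces

variable {U : Type*} [NormedAddCommGroup U] [NormedSpace ℝ U] [MeasurableSpace U] [BorelSpace U]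
  [SecondCountableTopology U] {ν : Measure U}
variable {P : Type*} [NormedAddCommGroup P] [NormedSpace ℝ P] [FiniteDimensional ℝ P]
variable {F : Type*} [NormedAddCommGroup F] [NormedSpace ℝ F]

omit [MeasurableSpace U] [BorelSpace U] [SecondCountableTopology U] [FiniteDimensional ℝ P] in
/-- The partial derivative in the (first) parameter of `G : P × U → F`. [folklore] -/
theorem hasFDerivAt_comp_prodMk_left {G : P × U → F} {n : WithTop ℕ∞} (hG : ContDiff ℝ n G)
    (hn : n ≠ 0) (p : P) (u : U) :
    HasFDerivAt (fun q : P => G (q, u)) ((fderiv ℝ G (p, u)).comp (ContinuousLinearMap.inl ℝ P U)) p := by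
  have h1 : HasFDerivAt G (fderiv ℝ G (p, u)) (p, u) := ((hG.differentiable hn) (p, u)).hasFDerivAt
  have h2 : HasFDerivAt (fun q : P => ((q, u) : P × U)) (ContinuousLinearMap.inl ℝ P U) p :=
    (hasFDerivAt_id p).prodMk (hasFDerivAt_const u p)
  exact h1.comp p h2

omit [FiniteDimensional ℝ P] [NormedSpace ℝ U] [NormedSpace ℝ P] in
/-- Measurability of the sections `u ↦ G (p, u)`. [folklore] -/
theorem aestronglyMeasurable_section_left {X : Type*} [TopologicalSpace X]
    [TopologicalSpace.PseudoMetrizableSpace X] {G : P × U → X} (hG : Continuous G) (p : P) (μ : Measure U) :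
    AEStronglyMeasurable (fun u => G (p, u)) μ :=
  (hG.comp (Continuous.prodMk_right p)).aestronglyMeasurable

omit [FiniteDimensional ℝ P] [NormedSpace ℝ U] [NormedSpace ℝ P] in
/-- **Continuity of dominated parametric integrals.** [folklore] -/
theorem continuous_parametric_integral_of_dominated {G : P × U → F} (hG : Continuous G)
    {b₀ : U → ℝ} (hb₀ : Integrable b₀ ν) (h₀ : ∀ p u, ‖G (p, u)‖ ≤ b₀ u) :
    Continuous fun p : P => ∫ u, G (p, u) ∂ν :=
  continuous_of_dominated (fun p => aestronglyMeasurable_section_left hG p ν)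
    (fun p => Eventually.of_forall fun u => h₀ p u) hb₀
    (Eventually.of_forall fun u => (hG.comp (Continuous.prodMk_left u)))

omit [FiniteDimensional ℝ P] in
/-- **One derivative under a dominated integral sign.** If `G : P × U → F` is `C¹` with
`‖G (p, u)‖ ≤ b₀(u)` and `‖DG (p, u)‖ ≤ b₁(u)` for integrable `b₀, b₁`, then `p ↦ ∫ G (p, u) dν`
has derivative `∫ D G (p, u) ∘ (·, 0) dν`. [folklore] -/
theorem hasFDerivAt_parametric_integral_of_dominated {G : P × U → F} {n : WithTop ℕ∞}
    (hG : ContDiff ℝ n G) (hn : n ≠ 0) {b₀ b₁ : U → ℝ} (hb₀ : Integrable b₀ ν) (hb₁ : Integrable b₁ ν)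
    (h₀ : ∀ p u, ‖G (p, u)‖ ≤ b₀ u) (h₁ : ∀ p u, ‖fderiv ℝ G (p, u)‖ ≤ b₁ u) (p₀ : P) :
    HasFDerivAt (fun p : P => ∫ u, G (p, u) ∂ν)
      (∫ u, (fderiv ℝ G (p₀, u)).comp (ContinuousLinearMap.inl ℝ P U) ∂ν) p₀ := by
  have hGc : Continuous G := hG.continuous
  have hDc : Continuous (fderiv ℝ G) := hG.continuous_fderiv hn
  set D : P × U → P →L[ℝ] F := fun q => (fderiv ℝ G q).comp (ContinuousLinearMap.inl ℝ P U) with hD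
  have hDcont : Continuous D :=
    ((ContinuousLinearMap.compL ℝ P (P × U) F).flip (ContinuousLinearMap.inl ℝ P U)).continuous.comp hDc
  have hDle : ∀ q, ‖D q‖ ≤ ‖fderiv ℝ G q‖ := fun q => by
    refine (ContinuousLinearMap.opNorm_comp_le _ _).trans ?_
    calc ‖fderiv ℝ G q‖ * ‖ContinuousLinearMap.inl ℝ P U‖ ≤ ‖fderiv ℝ G q‖ * 1 :=
          mul_le_mul_of_nonneg_left (ContinuousLinearMap.norm_inl_le_one ℝ P U) (norm_nonneg _)
      _ = _ := mul_one _
  refine hasFDerivAt_integral_of_dominated_of_fderiv_le (F := fun p u => G (p, u)) (F' := fun p u => D (p, u))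
    (bound := b₁) (ball_mem_nhds p₀ one_pos) ?_ ?_ ?_ ?_ hb₁ ?_
  · exact Eventually.of_forall fun p => aestronglyMeasurable_section_left hGc p ν
  · exact hb₀.mono' (aestronglyMeasurable_section_left hGc p₀ ν) (Eventually.of_forall fun u => h₀ p₀ u)
  · exact aestronglyMeasurable_section_left hDcont p₀ ν
  · exact Eventually.of_forall fun u p _ => (hDle (p, u)).trans (h₁ p u)
  · exact Eventually.of_forall fun u p _ => hasFDerivAt_comp_prodMk_left hG hn p u

omit [FiniteDimensional ℝ P] in
/-- The derivative in the direction `v`: the dominated parametric integral of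
`(p, u) ↦ D G (p, u) (v, 0)`. [folklore] -/
theorem fderiv_parametric_integral_of_dominated_apply {G : P × U → F} {n : WithTop ℕ∞}
    (hG : ContDiff ℝ n G) (hn : n ≠ 0) {b₀ b₁ : U → ℝ} (hb₀ : Integrable b₀ ν) (hb₁ : Integrable b₁ ν)
    (h₀ : ∀ p u, ‖G (p, u)‖ ≤ b₀ u) (h₁ : ∀ p u, ‖fderiv ℝ G (p, u)‖ ≤ b₁ u) (p : P) (v : P) :
    fderiv ℝ (fun p : P => ∫ u, G (p, u) ∂ν) p v = ∫ u, fderiv ℝ G (p, u) (v, (0 : U)) ∂ν := by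
  rw [(hasFDerivAt_parametric_integral_of_dominated hG hn hb₀ hb₁ h₀ h₁ p).fderiv]
  have hDc : Continuous (fderiv ℝ G) := hG.continuous_fderiv hn
  have hDcont : Continuous fun q : P × U => (fderiv ℝ G q).comp (ContinuousLinearMap.inl ℝ P U) :=
    ((ContinuousLinearMap.compL ℝ P (P × U) F).flip (ContinuousLinearMap.inl ℝ P U)).continuous.comp hDc
  have hint : Integrable (fun u => (fderiv ℝ G (p, u)).comp (ContinuousLinearMap.inl ℝ P U)) ν := by
    refine hb₁.mono' (aestronglyMeasurable_section_left hDcont p ν) (Eventually.of_forall fun u => ?_)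
    refine (ContinuousLinearMap.opNorm_comp_le _ _).trans ?_
    calc ‖fderiv ℝ G (p, u)‖ * ‖ContinuousLinearMap.inl ℝ P U‖ ≤ ‖fderiv ℝ G (p, u)‖ * 1 :=
          mul_le_mul_of_nonneg_left (ContinuousLinearMap.norm_inl_le_one ℝ P U) (norm_nonneg _)
      _ ≤ b₁ u := by rw [mul_one]; exact h₁ p u
  rw [ContinuousLinearMap.integral_apply hint]
  rfl

omit [BorelSpace U] [SecondCountableTopology U] [FiniteDimensional ℝ P] in
/-- **The dominated class**: smooth `G : P × U → F` all of whose iterated derivatives are bounded,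
uniformly in the parameter, by integrable functions of the integration variable. It is stable
under directional differentiation in the parameter. [folklore] -/
theorem dominated_fderiv_apply {G : P × U → F} (hG : ContDiff ℝ ∞ G)
    (hb : ∀ n : ℕ, ∃ b : U → ℝ, Integrable b ν ∧ ∀ p u, ‖iteratedFDeriv ℝ n G (p, u)‖ ≤ b u) (v : P) :
    ContDiff ℝ ∞ (fun q : P × U => fderiv ℝ G q (v, (0 : U))) ∧
      ∀ n : ℕ, ∃ b : U → ℝ, Integrable b ν ∧
        ∀ p u, ‖iteratedFDeriv ℝ n (fun q : P × U => fderiv ℝ G q (v, (0 : U))) (p, u)‖ ≤ b u := by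
  refine ⟨(hG.fderiv_right (m := ∞) le_rfl).clm_apply contDiff_const, fun n => ?_⟩
  obtain ⟨b, hbi, hb'⟩ := hb (n + 1)
  refine ⟨fun u => ‖(v, (0 : U))‖ * b u, hbi.const_mul _, fun p u => ?_⟩
  -- `D^n (q ↦ DG q w) = (eval w) ∘ D^n (DG)` and `‖D^n (DG)‖ = ‖D^{n+1} G‖`
  have h1 : (fun q : P × U => fderiv ℝ G q (v, (0 : U))) =
      (ContinuousLinearMap.apply ℝ F (v, (0 : U))) ∘ fderiv ℝ G := by
    funext q; rfl
  rw [h1, ContinuousLinearMap.iteratedFDeriv_comp_left _ ((hG.fderiv_right (m := ∞) le_rfl).contDiffAt)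
    (by exact_mod_cast le_top)]
  have happly : ‖ContinuousLinearMap.apply ℝ F (v, (0 : U))‖ ≤ ‖(v, (0 : U))‖ :=
    ContinuousLinearMap.opNorm_le_bound _ (norm_nonneg _) fun f => by
      rw [ContinuousLinearMap.apply_apply, mul_comm]; exact f.le_opNorm _
  calc ‖(ContinuousLinearMap.apply ℝ F (v, (0 : U))).compContinuousMultilinearMap (iteratedFDeriv ℝ n (fderiv ℝ G) (p, u))‖
      ≤ ‖ContinuousLinearMap.apply ℝ F (v, (0 : U))‖ * ‖iteratedFDeriv ℝ n (fderiv ℝ G) (p, u)‖ :=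
        ContinuousLinearMap.norm_compContinuousMultilinearMap_le _ _
    _ ≤ ‖(v, (0 : U))‖ * b u := by
        rw [norm_iteratedFDeriv_fderiv]
        exact mul_le_mul happly (hb' p u) (norm_nonneg _) (norm_nonneg _)

omit [BorelSpace U] [SecondCountableTopology U] [FiniteDimensional ℝ P] in
/-- Level-`0` and level-`1` bounds from the dominated class. [folklore] -/
theorem dominated_bounds_zero_one {G : P × U → F}
    (hb : ∀ n : ℕ, ∃ b : U → ℝ, Integrable b ν ∧ ∀ p u, ‖iteratedFDeriv ℝ n G (p, u)‖ ≤ b u) :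
    (∃ b₀ : U → ℝ, Integrable b₀ ν ∧ ∀ p u, ‖G (p, u)‖ ≤ b₀ u) ∧
      ∃ b₁ : U → ℝ, Integrable b₁ ν ∧ ∀ p u, ‖fderiv ℝ G (p, u)‖ ≤ b₁ u := by
  constructor
  · obtain ⟨b, hbi, h⟩ := hb 0
    exact ⟨b, hbi, fun p u => by rw [← norm_iteratedFDeriv_zero (𝕜 := ℝ)]; exact h p u⟩
  · obtain ⟨b, hbi, h⟩ := hb 1
    refine ⟨b, hbi, fun p u => ?_⟩
    rw [← norm_iteratedFDeriv_zero (𝕜 := ℝ) (f := fderiv ℝ G), norm_iteratedFDeriv_fderiv]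
    exact h p u

/-- `C^n` regularity of dominated parametric integrals, every `n : ℕ` (induction over the
dominated class, which is stable under directional derivatives). [folklore] -/
theorem contDiff_nat_parametric_integral_of_dominated :
    ∀ (n : ℕ) {G : P × U → F}, ContDiff ℝ ∞ G →
      (∀ k : ℕ, ∃ b : U → ℝ, Integrable b ν ∧ ∀ p u, ‖iteratedFDeriv ℝ k G (p, u)‖ ≤ b u) →
        ContDiff ℝ n fun p : P => ∫ u, G (p, u) ∂ν
  | 0, G, hG, hb => by
    obtain ⟨⟨b₀, hb₀, h₀⟩, -⟩ := dominated_bounds_zero_one hb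
    rw [Nat.cast_zero, contDiff_zero]
    exact continuous_parametric_integral_of_dominated hG.continuous hb₀ h₀
  | n + 1, G, hG, hb => by
    have h1 : (∞ : WithTop ℕ∞) ≠ 0 := by exact_mod_cast WithTop.coe_ne_zero.2 (by decide)
    obtain ⟨⟨b₀, hb₀, h₀⟩, ⟨b₁, hb₁, h₁'⟩⟩ := dominated_bounds_zero_one hb
    rw [Nat.cast_succ, contDiff_succ_iff_fderiv_apply]
    refine ⟨fun p => (hasFDerivAt_parametric_integral_of_dominated hG h1 hb₀ hb₁ h₀ h₁' p).differentiableAt,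
      fun h => ?_, fun v => ?_⟩
    · exact absurd h (by exact_mod_cast WithTop.coe_ne_top)
    · have hv : (fun p : P => fderiv ℝ (fun p : P => ∫ u, G (p, u) ∂ν) p v) =
          fun p : P => ∫ u, fderiv ℝ G (p, u) (v, (0 : U)) ∂ν :=
        funext fun p => fderiv_parametric_integral_of_dominated_apply hG h1 hb₀ hb₁ h₀ h₁' p v
      rw [hv]
      obtain ⟨hG', hb'⟩ := dominated_fderiv_apply hG hb v
      exact contDiff_nat_parametric_integral_of_dominated n hG' hb'

/-- **Smooth dependence on parameters of dominated integrals.** If `G : P × U → F` is smooth and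
every iterated derivative of `G` is bounded, uniformly in the parameter `p`, by an integrable
function of `u`, then `p ↦ ∫ G (p, u) dν(u)` is `C^∞`. (Used for velocity moments
`x ↦ ∫ h(x, u) du` of functions with Schwartz-type bounds.) [folklore] -/
theorem contDiff_parametric_integral_of_dominated {G : P × U → F} (hG : ContDiff ℝ ∞ G)
    (hb : ∀ n : ℕ, ∃ b : U → ℝ, Integrable b ν ∧ ∀ p u, ‖iteratedFDeriv ℝ n G (p, u)‖ ≤ b u) :
    ContDiff ℝ ∞ fun p : P => ∫ u, G (p, u) ∂ν :=
  contDiff_infty.2 fun n => contDiff_nat_parametric_integral_of_dominated n hG hb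

omit [MeasurableSpace U] [BorelSpace U] [SecondCountableTopology U] [FiniteDimensional ℝ P] in
/-- Partial iterated derivatives through total ones (parameter in the first factor). [folklore] -/
theorem iteratedFDeriv_section_left {G : P × U → F} (hG : ContDiff ℝ ∞ G) (p : P) (u : U) (n : ℕ) :
    iteratedFDeriv ℝ n (fun r : P => G (r, u)) p =
      (iteratedFDeriv ℝ n G (p, u)).compContinuousLinearMap fun _ => ContinuousLinearMap.inl ℝ P U := by
  set G' : P × U → F := fun r => G (r + (0, u)) with hG'
  have hG's : ContDiff ℝ ∞ G' := hG.comp (contDiff_id.add contDiff_const)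
  have h1 : (fun r : P => G (r, u)) = G' ∘ (ContinuousLinearMap.inl ℝ P U) := by
    funext r; simp [hG']
  rw [h1, ContinuousLinearMap.iteratedFDeriv_comp_right _ hG's _ (by exact_mod_cast le_top)]
  have h2 : iteratedFDeriv ℝ n G' (ContinuousLinearMap.inl ℝ P U p) = iteratedFDeriv ℝ n G (p, u) := by
    rw [hG', iteratedFDeriv_comp_add_right]
    simp
  rw [h2]

omit [MeasurableSpace U] [BorelSpace U] [SecondCountableTopology U] [FiniteDimensional ℝ P] in
/-- Norm comparison of partial and total iterated derivatives: `‖D_p^n G (·, u) (p)‖ ≤ ‖D^n G (p, u)‖`.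
[folklore] -/
theorem norm_iteratedFDeriv_section_left_le {G : P × U → F} (hG : ContDiff ℝ ∞ G) (p : P) (u : U)
    (n : ℕ) : ‖iteratedFDeriv ℝ n (fun r : P => G (r, u)) p‖ ≤ ‖iteratedFDeriv ℝ n G (p, u)‖ := by
  rw [iteratedFDeriv_section_left hG p u n]
  refine (ContinuousMultilinearMap.norm_compContinuousLinearMap_le _ _).trans ?_
  calc ‖iteratedFDeriv ℝ n G (p, u)‖ * ∏ _i : Fin n, ‖ContinuousLinearMap.inl ℝ P U‖
      ≤ ‖iteratedFDeriv ℝ n G (p, u)‖ * ∏ _i : Fin n, (1 : ℝ) := by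
        refine mul_le_mul_of_nonneg_left (Finset.prod_le_prod (fun _ _ => norm_nonneg _)
          fun _ _ => ContinuousLinearMap.norm_inl_le_one ℝ P U) (norm_nonneg _)
    _ = _ := by simp

omit [MeasurableSpace U] [BorelSpace U] [SecondCountableTopology U] [FiniteDimensional ℝ P] in
/-- The partial iterated derivative `(p, u) ↦ D_p^n G (·, u) (p)` is smooth. [folklore] -/
theorem contDiff_iteratedFDeriv_section_left {G : P × U → F} (hG : ContDiff ℝ ∞ G) (n : ℕ) :
    ContDiff ℝ ∞ fun q : P × U => iteratedFDeriv ℝ n (fun r : P => G (r, q.2)) q.1 := by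
  have h : (fun q : P × U => iteratedFDeriv ℝ n (fun r : P => G (r, q.2)) q.1) =
      (ContinuousMultilinearMap.compContinuousLinearMapL (fun _ => ContinuousLinearMap.inl ℝ P U)) ∘
        iteratedFDeriv ℝ n G := by
    funext q
    rw [iteratedFDeriv_section_left hG q.1 q.2 n]
    rfl
  rw [h]
  exact (ContinuousLinearMap.contDiff _).comp (hG.iteratedFDeriv_right (by exact_mod_cast le_top))

omit [BorelSpace U] [SecondCountableTopology U] [FiniteDimensional ℝ P] in
/-- Level-`0` and level-`1` dominated bounds for the partial iterated derivative
`H_n (p, u) = D_p^n G (·, u) (p)`: by `b_n` and `b_{n+1}`. [folklore] -/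
theorem dominated_iteratedFDeriv_section_zero_one {G : P × U → F} (hG : ContDiff ℝ ∞ G)
    (hb : ∀ n : ℕ, ∃ b : U → ℝ, Integrable b ν ∧ ∀ p u, ‖iteratedFDeriv ℝ n G (p, u)‖ ≤ b u) (n : ℕ) :
    (∃ b₀ : U → ℝ, Integrable b₀ ν ∧ ∀ p u, ‖iteratedFDeriv ℝ n (fun r : P => G (r, u)) p‖ ≤ b₀ u) ∧
      ∃ b₁ : U → ℝ, Integrable b₁ ν ∧ ∀ p u,
        ‖fderiv ℝ (fun q : P × U => iteratedFDeriv ℝ n (fun r : P => G (r, q.2)) q.1) (p, u)‖ ≤ b₁ u := by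
  constructor
  · obtain ⟨b, hbi, hb'⟩ := hb n
    exact ⟨b, hbi, fun p u => (norm_iteratedFDeriv_section_left_le hG p u n).trans (hb' p u)⟩
  · obtain ⟨b, hbi, hb'⟩ := hb (n + 1)
    refine ⟨b, hbi, fun p u => ?_⟩
    set Lc : ContinuousMultilinearMap ℝ (fun _ : Fin n => P × U) F →L[ℝ] ContinuousMultilinearMap ℝ (fun _ : Fin n => P) F :=
      ContinuousMultilinearMap.compContinuousLinearMapL (fun _ => ContinuousLinearMap.inl ℝ P U) with hLc
    have hL : ‖Lc‖ ≤ 1 := by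
      refine ContinuousLinearMap.opNorm_le_bound _ zero_le_one fun M => ?_
      rw [one_mul]
      refine (ContinuousMultilinearMap.norm_compContinuousLinearMap_le _ _).trans ?_
      calc ‖M‖ * ∏ _i : Fin n, ‖ContinuousLinearMap.inl ℝ P U‖ ≤ ‖M‖ * ∏ _i : Fin n, (1 : ℝ) := by
            refine mul_le_mul_of_nonneg_left (Finset.prod_le_prod (fun _ _ => norm_nonneg _)
              fun _ _ => ContinuousLinearMap.norm_inl_le_one ℝ P U) (norm_nonneg _)
        _ = ‖M‖ := by simp
    have h : (fun q : P × U => iteratedFDeriv ℝ n (fun r : P => G (r, q.2)) q.1) = Lc ∘ iteratedFDeriv ℝ n G := by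
      funext q
      rw [iteratedFDeriv_section_left hG q.1 q.2 n]
      rfl
    have hDn : Differentiable ℝ (iteratedFDeriv ℝ n G) :=
      (hG.iteratedFDeriv_right (i := n) (m := 1) (by exact_mod_cast le_top)).differentiable one_ne_zero
    rw [h, (Lc.hasFDerivAt.comp (p, u) (hDn (p, u)).hasFDerivAt).fderiv]
    calc ‖Lc.comp (fderiv ℝ (iteratedFDeriv ℝ n G) (p, u))‖ ≤ ‖Lc‖ * ‖fderiv ℝ (iteratedFDeriv ℝ n G) (p, u)‖ :=
          ContinuousLinearMap.opNorm_comp_le _ _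
      _ ≤ 1 * ‖iteratedFDeriv ℝ (n + 1) G (p, u)‖ := by
          rw [norm_fderiv_iteratedFDeriv]; exact mul_le_mul_of_nonneg_right hL (norm_nonneg _)
      _ ≤ b u := by rw [one_mul]; exact hb' p u

omit [FiniteDimensional ℝ P] in
/-- **Iterated differentiation under a dominated integral sign**: all iterated derivatives of
`p ↦ ∫ G (p, u) dν` are the integrals of the iterated derivatives of the sections. [folklore] -/
theorem iteratedFDeriv_parametric_integral_of_dominated {G : P × U → F} (hG : ContDiff ℝ ∞ G)
    (hb : ∀ n : ℕ, ∃ b : U → ℝ, Integrable b ν ∧ ∀ p u, ‖iteratedFDeriv ℝ n G (p, u)‖ ≤ b u) :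
    ∀ (n : ℕ) (p : P), iteratedFDeriv ℝ n (fun p : P => ∫ u, G (p, u) ∂ν) p =
      ∫ u, iteratedFDeriv ℝ n (fun r : P => G (r, u)) p ∂ν
  | 0, p => by
    simp only [iteratedFDeriv_zero_eq_comp, Function.comp_apply]
    exact ((continuousMultilinearCurryFin0 ℝ P F).symm.toContinuousLinearEquiv.integral_comp_comm _).symm
  | n + 1, p => by
    have h1 : (∞ : WithTop ℕ∞) ≠ 0 := by exact_mod_cast WithTop.coe_ne_zero.2 (by decide)
    set H : P × U → ContinuousMultilinearMap ℝ (fun _ : Fin n => P) F :=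
      fun q => iteratedFDeriv ℝ n (fun r : P => G (r, q.2)) q.1 with hH
    have hHs : ContDiff ℝ ∞ H := contDiff_iteratedFDeriv_section_left hG n
    obtain ⟨⟨b₀, hb₀, h₀⟩, ⟨b₁, hb₁, h₁'⟩⟩ := dominated_iteratedFDeriv_section_zero_one hG hb n
    have hIH : iteratedFDeriv ℝ n (fun p : P => ∫ u, G (p, u) ∂ν) = fun p => ∫ u, H (p, u) ∂ν :=
      funext fun p => iteratedFDeriv_parametric_integral_of_dominated hG hb n p
    rw [iteratedFDeriv_succ_eq_comp_left, Function.comp_apply, hIH,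
      (hasFDerivAt_parametric_integral_of_dominated hHs h1 hb₀ hb₁ h₀ h₁' p).fderiv]
    set L := (continuousMultilinearCurryLeftEquiv ℝ (fun _ : Fin (n + 1) => P) F).symm with hL
    have hcomm : L (∫ u, (fderiv ℝ H (p, u)).comp (ContinuousLinearMap.inl ℝ P U) ∂ν) =
        ∫ u, L ((fderiv ℝ H (p, u)).comp (ContinuousLinearMap.inl ℝ P U)) ∂ν := by
      have h := ContinuousLinearEquiv.integral_comp_comm (𝕜 := ℝ) (μ := ν) L.toContinuousLinearEquiv
        (fun u => (fderiv ℝ H (p, u)).comp (ContinuousLinearMap.inl ℝ P U))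
      exact h.symm
    rw [hcomm]
    refine integral_congr_ae (Eventually.of_forall fun u => ?_)
    have hfd : (fderiv ℝ H (p, u)).comp (ContinuousLinearMap.inl ℝ P U) =
        fderiv ℝ (iteratedFDeriv ℝ n fun r : P => G (r, u)) p :=
      (hasFDerivAt_comp_prodMk_left hHs h1 p u).fderiv.symm
    simp only [hL, hfd, iteratedFDeriv_succ_eq_comp_left, Function.comp_apply]

omit [FiniteDimensional ℝ P] in
/-- **Norm bound for iterated derivatives of dominated parametric integrals**:
`‖D^n (∫ G (·, u) dν) (p)‖ ≤ ∫ ‖D^n G (p, u)‖ dν ≤ ∫ b_n dν`. [folklore] -/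
theorem norm_iteratedFDeriv_parametric_integral_of_dominated_le {G : P × U → F} (hG : ContDiff ℝ ∞ G)
    (hb : ∀ n : ℕ, ∃ b : U → ℝ, Integrable b ν ∧ ∀ p u, ‖iteratedFDeriv ℝ n G (p, u)‖ ≤ b u)
    (n : ℕ) (p : P) {b : U → ℝ} (hbi : Integrable b ν) (hbn : ∀ p u, ‖iteratedFDeriv ℝ n G (p, u)‖ ≤ b u) :
    ‖iteratedFDeriv ℝ n (fun p : P => ∫ u, G (p, u) ∂ν) p‖ ≤ ∫ u, b u ∂ν := by
  rw [iteratedFDeriv_parametric_integral_of_dominated hG hb n p]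
  refine (norm_integral_le_integral_norm _).trans (integral_mono_of_nonneg (Eventually.of_forall fun u => norm_nonneg _)
    hbi (Eventually.of_forall fun u => ?_))
  exact (norm_iteratedFDeriv_section_left_le hG p u n).trans (hbn p u)

end Literature.Analysis.FunctionSpaces

end
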